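import Summits.QuantumFields.BalabanUV.Beta.GAN24.LinT2CoDressedStep
import Summits.QuantumFields.BalabanUV.Beta.GAN24.CoProjBmDivFree
import Summits.QuantumFields.BalabanUV.Beta.GAN24.Lin4Additive

/-!
# `BalabanUV.Beta.GAN24.TableDressingDefect` — binder row G-an2-4 ∕ (CONV-C), CT-W ∕ route of record (R-DEV) (the row owner's RULING R-gan24p1-g23-1,
# journal l.37889; his W3 → leaf-06 of [GAN24P1-G23-ONLINE] l.37785, (a) «`(𝔇 − 1) Y` = signed sum of ONE-SLOT defects», first refusal leaf-06):
# **THE TABLE DRESSING `𝔇` MINUS THE IDENTITY IS FOUR ONE-SLOT DEFECTS, EACH THE PAIRING OF THAT SLOT's DIVERGENCE WITH A BLOCK-LOCAL POTENTIAL;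
# TRANSVERSAL SLOTS DROP; AND THE ONE-LEVEL DIFFERENCE `𝒜^E_j X − 𝒜^B_j X = 𝒜^B_j ((𝔇 − 1) X)`**

NOT IN PRINT; OUR BOOKKEEPING (G-an2-4 crux team (2), leaf prover `b2b-balaban-gan24-formalise-leaf-06`, gen 43; journal INTENT [GAN24LEAF06-G43-INTENT1]).
HONEST FRAMING (cell contract, verbatim): «discharging `BetaPertH` makes Bałaban's UV stability UNCONDITIONAL — a real constructive-QFT result; it is NOT the
continuum limit and NOT the Clay problem.»  HONEST DEPENDENCY (verbatim): «continuum YM on T⁴ ⇐ BetaPertH ∧ nine spine estimates (0/9 proved); BetaPertH ⇐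
(D1) ∧ (D4) ∧ CAP+tail; G-an2-4 gates asym, D1 and NE2/3/4.»

WHY.  PART 1 ∕ 2 (`LinT2CoDressed(Step)`): co-dressing the resolvent is dressing the table — `lin4 c (Πᵀ K Π) N X = lin4 c K N (𝔇 X)` with ONE `j`-free, `K`-free
table operation `𝔇 X κ u κ′ u′ := dressKBmAt ρ N (coProjBmAtK ρ N (fun κ₁ u₁ ↦ coProjBmAtK ρ N (X κ₁ u₁) κ′ u′) κ u)`.  The route of record (R-DEV) (the row owner's
`F2-NUMERIC-v0.md` §4) runs the DEVIATION tower `D_{j+1} = 𝒜^E_j D_j + g′_j` with forcing `g′_j = 𝒜^B_j ((𝔇 − 1) T_j) + (b̃_j − b_j)`; its rows (G′) (shape of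
`g′_j`) and its mechanism «one leg at a time» want `𝔇 − 1` displayed slot by slot.  `𝔇` is the composite of FOUR commuting-in-spirit one-variable operators, each
a `Πᵀ_bm` (an2's window operator `coProjBmAt`) acting on ONE variable of the table: the second source slot `(κ′, u′)` (`P₂`), the first source slot `(κ, u)`
(`P₁`), the first kernel leg `(x, a)` (`L₁ = legCo₁BmAt`), the second kernel leg `(z, b)` (`L₂ = legCo₂BmAt`) — an2's `dressKBmAt_eq_legs`.  Hence
`𝔇 − 1 = (P₂ − 1) + (P₁ − 1) P₂ + (L₁ − 1) P₁ P₂ + (L₂ − 1) L₁ P₁ P₂` (telescoping), and by leaf-02 g51's `CoProjBmDivFree.coProjBmAt_eq_self_sub_tsum_div` each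
`Πᵀ_bm − 1` on a variable is `g ↦ Σ'_p φ_{α,q}(p) · (div g)(p)` — the pairing of the slot's DIVERGENCE (its Ward contact term) with the block-supported potential
`φ_{α,q} = bmGaugeAt ρ δ_{(α,q)} N`.  These are the (R-CT) «contact cells»; a slot that is divergence-free contributes nothing (leaf-02's §3∕§4), and a table
transversal in all four variables is `𝔇`-fixed, so on it the dressed and undressed linear steps agree.

WHAT ([folklore] slot bookkeeping BY NAME; generic `d`; `ρ` any root offset for §1–§2, in-block root `ρ = toSite r`, `1 ≤ N` from §3 on; the four operators are
written as lambdas — 0 `def`, 0 cite, 0 `def … : Prop`, 0 sorry):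
§1 `tableDress_eq_legs` — `𝔇 X = L₂ (L₁ (P₁ (P₂ X)))`.
§2 **`tableDress_sub_self`** — `𝔇 X − X` = the four one-slot defects (pointwise telescoping).
§3 THE DEFECTS IN DIVERGENCE FORM — `coProj_snd_sub_self_apply`, `coProj_fst_sub_self_apply` (source slots), `legCo₁_sub_self_inl ∕ _inr`, `legCo₂_sub_self_inl ∕ _inr`
   (kernel legs; multiplier components untouched).
§4 TRANSVERSAL SLOTS DROP — `coProj_snd_eq_self_of_divFree`, `coProj_fst_eq_self_of_divFree`, `legCo₁_eq_self_of_divFree`, `legCo₂_eq_self_of_divFree`,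
   **`tableDress_eq_self_of_transversal`**.
§5 SHAPES — `locStencil₂_tableDress` (constant `κ_𝔇·C`, `κ_𝔇 = cKb·cKb·(cWb·e^{3δ(d+1)N}·cKb)`, same rate; PART 1 §2 chained), `locStencil₂_diff`, `locStencil₂_tableDress_sub_self`
   (constant `(κ_𝔇 + 1)·C`), `bdd_of_locStencil₂`.
§6 THE ONE-LEVEL DIFFERENCE — **`lin4_coDressKBmAt_sub`**: `lin4 c (coDressKBmAt ρ N K) N X − lin4 c K N X = lin4 c K N (𝔇 X − X)` (decaying `K`, `LocStencil₂` table at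
   the same rate; PART 1 `lin4_coDressKBmAt` + leaf-01's `Lin4Additive.lin4_sub`), and the comb instance **`lin4_comb_coDressKBmAt_sub`** in the adopted units
   (PART 2 `lin4_comb_coDressKBmAt`): `𝒜^E_j X − 𝒜^B_j X = 𝒜^B_j (𝔇 X − X)` — the first summand of the (R-DEV) forcing as ONE undressed `lin4` of the four cells.
Asserts NO value of any slot divergence of Bałaban's tables and NO estimate; discharges NOTHING of (Z′) ∕ (G′) ∕ (F3ᴱ-irr) ∕ «T2Shape» ∕ «T2Drift» ∕ (hW, hWall);
0 wall binders; NEVER «G-an2-4 closed» as (CONV-C); NOT D1, NOT `BetaPertH`, NOT continuum, NOT Clay; not in print — our bookkeeping.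
Unit `b2b-balaban-gan24-formalise-leaf-06` (gen 43), 2026-08-22.
-/

noncomputable section

open Finset
open scoped BigOperators
open Literature.MathematicalPhysics.QuantumFieldTheory
open Literature.MathematicalPhysics.QuantumFieldTheory.Balaban1983to89
open Literature.MathematicalPhysics.QuantumFieldTheory.Balaban1983to89.Beta
open B12Sec2to5 (l1 l1_nonneg)
open ExpKernelCalculus (MKer Site Decays BiLoc shiftK)
open AffineAveraging (Form0 Form1 box toSite unitVec)
open OneStepResolventKernel (Fib decays_mono)
open OneStepKernelFamily (KInvStep decays_KInvStep)
open BalabanCompositeJets (LocStencil₂)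
open Summit.QuantumFields.BalabanUV.Beta.AxialProjectorBlockMean (bmGaugeAt)
open Summit.QuantumFields.BalabanUV.Beta.AxialDressingRooted (bondInd cube cWb cWb_nonneg cKb cKb_nonneg coProjBmAt coProjBmAtK coProjBmAtK_eval
  coDressKBmAt dressKBmAt legCo₁BmAt legCo₂BmAt legCo₁BmAt_inl legCo₁BmAt_inr legCo₂BmAt_inl legCo₂BmAt_inr dressKBmAt_eq_legs one_le_of_neZero)
open Summit.QuantumFields.BalabanUV.Beta.HessKerDressedUnits (unitK decays_unitK)
open Summit.QuantumFields.BalabanUV.Beta.GAN24.BiStencilZeroMode (Tab)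
open Summit.QuantumFields.BalabanUV.Beta.GAN24.T2RecursionAffine (lin4)
open Summit.QuantumFields.BalabanUV.Beta.GAN24.CombesThomas (sfStep smStep sfStep_ne_zero smStep_ne_zero)
open Summit.QuantumFields.BalabanUV.Beta.GAN24.LinT2CoDressed (locStencil₂_coProj_snd locStencil₂_coProj_fst locStencil₂_dress lin4_coDressKBmAt)
open Summit.QuantumFields.BalabanUV.Beta.GAN24.LinT2CoDressedStep (lin4_unitK_coDressKBmAt)
open Summit.QuantumFields.BalabanUV.Beta.GAN24.CoProjBmDivFree (coProjBmAt_eq_self_sub_tsum_div coProjBmAt_eq_self_of_divFree coProjBmAtK_eq_self_of_divFree)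
open Summit.QuantumFields.BalabanUV.Beta.GAN24.Lin4Additive (lin4_sub)

namespace Summit.QuantumFields.BalabanUV.Beta.GAN24.TableDressingDefect

variable {d : ℕ}

/-! ## §1 `𝔇` as the composite of four one-variable dressings -/

/-- [folklore] **`𝔇` IS FOUR ONE-VARIABLE `Πᵀ_bm`-DRESSINGS**: second source slot, first source slot, then the two kernel legs (an2's `dressKBmAt_eq_legs`):
`𝔇 X = L₂ (L₁ (P₁ (P₂ X)))` with `P₂ X := fun κ u ↦ coProjBmAtK ρ N (X κ u)`, `P₁ Y := fun κ u κ′ u′ ↦ coProjBmAtK ρ N (fun κ₁ u₁ ↦ Y κ₁ u₁ κ′ u′) κ u`,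
`L₁ Z := fun κ u κ′ u′ ↦ legCo₁BmAt ρ N (Z κ u κ′ u′)`, `L₂ Z := fun κ u κ′ u′ ↦ legCo₂BmAt ρ N (Z κ u κ′ u′)` (any root offset, any `N`). -/
theorem tableDress_eq_legs (ρ : Fin (d + 1) → ℤ) (N : ℕ) (X : Tab d) :
    (fun κ u κ' u' => dressKBmAt ρ N (coProjBmAtK ρ N (fun κ₁ u₁ => coProjBmAtK ρ N (X κ₁ u₁) κ' u') κ u))
      = fun κ u κ' u' => legCo₂BmAt ρ N (legCo₁BmAt ρ N (coProjBmAtK ρ N (fun κ₁ u₁ => coProjBmAtK ρ N (X κ₁ u₁) κ' u') κ u)) := by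
  funext κ u κ' u'
  rw [dressKBmAt_eq_legs]

/-! ## §2 `𝔇 − 1` is four one-slot defects -/

/-- NOT IN PRINT; OUR BOOKKEEPING.  **`𝔇 − 1` IS FOUR ONE-SLOT DEFECTS** (pointwise telescoping; any root offset, any `N`, any table):
`𝔇 X − X = (P₂ X − X) + (P₁ (P₂ X) − P₂ X) + (L₁ (P₁ P₂ X) − P₁ P₂ X) + (L₂ (L₁ P₁ P₂ X) − L₁ P₁ P₂ X)` — each bracket is `Πᵀ_bm − 1` acting on ONE variable
of a (partially dressed) table: the row owner's «signed sum of one-slot defects» (four, the kernel dressing being two legs). -/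
theorem tableDress_sub_self (ρ : Fin (d + 1) → ℤ) (N : ℕ) (X : Tab d) :
    (fun κ u κ' u' => dressKBmAt ρ N (coProjBmAtK ρ N (fun κ₁ u₁ => coProjBmAtK ρ N (X κ₁ u₁) κ' u') κ u)) - X
      = ((fun κ u => coProjBmAtK ρ N (X κ u)) - X)
        + ((fun κ u κ' u' => coProjBmAtK ρ N (fun κ₁ u₁ => coProjBmAtK ρ N (X κ₁ u₁) κ' u') κ u)
            - (fun κ u => coProjBmAtK ρ N (X κ u)))
        + ((fun κ u κ' u' => legCo₁BmAt ρ N (coProjBmAtK ρ N (fun κ₁ u₁ => coProjBmAtK ρ N (X κ₁ u₁) κ' u') κ u))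
            - (fun κ u κ' u' => coProjBmAtK ρ N (fun κ₁ u₁ => coProjBmAtK ρ N (X κ₁ u₁) κ' u') κ u))
        + ((fun κ u κ' u' => legCo₂BmAt ρ N (legCo₁BmAt ρ N (coProjBmAtK ρ N (fun κ₁ u₁ => coProjBmAtK ρ N (X κ₁ u₁) κ' u') κ u)))
            - (fun κ u κ' u' => legCo₁BmAt ρ N (coProjBmAtK ρ N (fun κ₁ u₁ => coProjBmAtK ρ N (X κ₁ u₁) κ' u') κ u))) := by
  rw [tableDress_eq_legs]
  abel

/-! ## §3 Each defect in divergence form: the pairing of the slot's divergence with the block-local potential -/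

section Defects

variable {N : ℕ} {r : Fin (d + 1) → ℕ}

/-- [folklore] `Πᵀ_bm − 1` on a one-form, in the DIVERGENCE orientation (leaf-02's `coProjBmAt_eq_self_sub_tsum_div` with the sign moved inside):
`coProjBmAt ρ N g α q − g α q = Σ'_p φ_{α,q} p · Σ_β (g β p − g β (p − e_β))`, `φ_{α,q} = bmGaugeAt ρ δ_{(α,q)} N`. -/
theorem coProjBmAt_sub_self_apply (hN : 1 ≤ N) (hr : r ∈ box (d + 1) N) (g : Form1 (d + 1) ℝ) (α : Fin (d + 1)) (q : Fin (d + 1) → ℤ) :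
    coProjBmAt (toSite r) N g α q - g α q
      = ∑' p : Fin (d + 1) → ℤ, bmGaugeAt (toSite r) (fun κ z => (bondInd α q κ z : ℝ)) N p * ∑ β : Fin (d + 1), (g β p - g β (p - unitVec β)) := by
  rw [coProjBmAt_eq_self_sub_tsum_div hN hr, sub_sub_cancel_left, ← tsum_neg]
  refine tsum_congr fun p => ?_
  rw [← mul_neg, ← Finset.sum_neg_distrib]
  congr 1
  exact Finset.sum_congr rfl fun β _ => neg_sub _ _

/-- NOT IN PRINT; OUR BOOKKEEPING.  **THE SECOND-SOURCE-SLOT DEFECT** (contact cell in the variable `(κ′, u′)`; in-block root, `1 ≤ N`, ANY table):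
`(P₂ X − X) κ u κ′ u′ x z a b = Σ'_p φ_{κ′,u′} p · Σ_β (X κ u β p x z a b − X κ u β (p − e_β) x z a b)`. -/
theorem coProj_snd_sub_self_apply (hN : 1 ≤ N) (hr : r ∈ box (d + 1) N) (X : Tab d) (κ : Fin (d + 1)) (u : Fin (d + 1) → ℤ) (κ' : Fin (d + 1))
    (u' x z : Fin (d + 1) → ℤ) (a b : Fib d) :
    ((fun κ u => coProjBmAtK (toSite r) N (X κ u)) - X) κ u κ' u' x z a b
      = ∑' p : Fin (d + 1) → ℤ, bmGaugeAt (toSite r) (fun κ₂ z₂ => (bondInd κ' u' κ₂ z₂ : ℝ)) N p *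
          ∑ β : Fin (d + 1), (X κ u β p x z a b - X κ u β (p - unitVec β) x z a b) := by
  show coProjBmAtK (toSite r) N (X κ u) κ' u' x z a b - X κ u κ' u' x z a b = _
  rw [coProjBmAtK_eval]
  exact coProjBmAt_sub_self_apply hN hr (fun κ₁ u₁ => X κ u κ₁ u₁ x z a b) κ' u'

/-- NOT IN PRINT; OUR BOOKKEEPING.  **THE FIRST-SOURCE-SLOT DEFECT** (contact cell in the variable `(κ, u)`; in-block root, `1 ≤ N`, ANY table `Y`):
`(P₁ Y − Y) κ u κ′ u′ x z a b = Σ'_p φ_{κ,u} p · Σ_β (Y β p κ′ u′ x z a b − Y β (p − e_β) κ′ u′ x z a b)`. -/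
theorem coProj_fst_sub_self_apply (hN : 1 ≤ N) (hr : r ∈ box (d + 1) N) (Y : Tab d) (κ : Fin (d + 1)) (u : Fin (d + 1) → ℤ) (κ' : Fin (d + 1))
    (u' x z : Fin (d + 1) → ℤ) (a b : Fib d) :
    ((fun κ u κ' u' => coProjBmAtK (toSite r) N (fun κ₁ u₁ => Y κ₁ u₁ κ' u') κ u) - Y) κ u κ' u' x z a b
      = ∑' p : Fin (d + 1) → ℤ, bmGaugeAt (toSite r) (fun κ₂ z₂ => (bondInd κ u κ₂ z₂ : ℝ)) N p *
          ∑ β : Fin (d + 1), (Y β p κ' u' x z a b - Y β (p - unitVec β) κ' u' x z a b) := by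
  show coProjBmAtK (toSite r) N (fun κ₁ u₁ => Y κ₁ u₁ κ' u') κ u x z a b - Y κ u κ' u' x z a b = _
  rw [coProjBmAtK_eval]
  exact coProjBmAt_sub_self_apply hN hr (fun κ₁ u₁ => Y κ₁ u₁ κ' u' x z a b) κ u

/-- NOT IN PRINT; OUR BOOKKEEPING.  **THE FIRST-KERNEL-LEG DEFECT, FIELD COMPONENT** (contact cell in the variable `(x, α)`; in-block root, `1 ≤ N`, ANY kernel `V`):
`(legCo₁BmAt ρ N V − V) x z (inl α) b = Σ'_p φ_{α,x} p · Σ_β (V p z (inl β) b − V (p − e_β) z (inl β) b)`. -/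
theorem legCo₁_sub_self_inl (hN : 1 ≤ N) (hr : r ∈ box (d + 1) N) (V : MKer (d + 1) (Fib d)) (x z : Fin (d + 1) → ℤ) (α : Fin (d + 1)) (b : Fib d) :
    (legCo₁BmAt (toSite r) N V - V) x z (Sum.inl α) b
      = ∑' p : Fin (d + 1) → ℤ, bmGaugeAt (toSite r) (fun κ₂ z₂ => (bondInd α x κ₂ z₂ : ℝ)) N p *
          ∑ β : Fin (d + 1), (V p z (Sum.inl β) b - V (p - unitVec β) z (Sum.inl β) b) := by
  show legCo₁BmAt (toSite r) N V x z (Sum.inl α) b - V x z (Sum.inl α) b = _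
  rw [legCo₁BmAt_inl]
  exact coProjBmAt_sub_self_apply hN hr (fun α' x' => V x' z (Sum.inl α') b) α x

/-- [folklore] The first-leg dressing does not touch the multiplier components: `(legCo₁BmAt ρ N V − V) x z (inr m) b = 0`. -/
theorem legCo₁_sub_self_inr (ρ : Fin (d + 1) → ℤ) (N : ℕ) (V : MKer (d + 1) (Fib d)) (x z : Fin (d + 1) → ℤ) (m : Fin (d + 1)) (b : Fib d) :
    (legCo₁BmAt ρ N V - V) x z (Sum.inr m) b = 0 := by
  show legCo₁BmAt ρ N V x z (Sum.inr m) b - V x z (Sum.inr m) b = 0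
  rw [legCo₁BmAt_inr, sub_self]

/-- NOT IN PRINT; OUR BOOKKEEPING.  **THE SECOND-KERNEL-LEG DEFECT, FIELD COMPONENT** (contact cell in the variable `(z, β₀)`; in-block root, `1 ≤ N`, ANY kernel `V`):
`(legCo₂BmAt ρ N V − V) x z a (inl β₀) = Σ'_p φ_{β₀,z} p · Σ_β (V x p a (inl β) − V x (p − e_β) a (inl β))`. -/
theorem legCo₂_sub_self_inl (hN : 1 ≤ N) (hr : r ∈ box (d + 1) N) (V : MKer (d + 1) (Fib d)) (x z : Fin (d + 1) → ℤ) (a : Fib d) (β₀ : Fin (d + 1)) :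
    (legCo₂BmAt (toSite r) N V - V) x z a (Sum.inl β₀)
      = ∑' p : Fin (d + 1) → ℤ, bmGaugeAt (toSite r) (fun κ₂ z₂ => (bondInd β₀ z κ₂ z₂ : ℝ)) N p *
          ∑ β : Fin (d + 1), (V x p a (Sum.inl β) - V x (p - unitVec β) a (Sum.inl β)) := by
  show legCo₂BmAt (toSite r) N V x z a (Sum.inl β₀) - V x z a (Sum.inl β₀) = _
  rw [legCo₂BmAt_inl]
  exact coProjBmAt_sub_self_apply hN hr (fun β' y' => V x y' a (Sum.inl β')) β₀ z

/-- [folklore] The second-leg dressing does not touch the multiplier components: `(legCo₂BmAt ρ N V − V) x z a (inr m) = 0`. -/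
theorem legCo₂_sub_self_inr (ρ : Fin (d + 1) → ℤ) (N : ℕ) (V : MKer (d + 1) (Fib d)) (x z : Fin (d + 1) → ℤ) (a : Fib d) (m : Fin (d + 1)) :
    (legCo₂BmAt ρ N V - V) x z a (Sum.inr m) = 0 := by
  show legCo₂BmAt ρ N V x z a (Sum.inr m) - V x z a (Sum.inr m) = 0
  rw [legCo₂BmAt_inr, sub_self]

end Defects

/-! ## §4 Transversal slots drop -/

section Transversal

variable {N : ℕ} {r : Fin (d + 1) → ℕ}

/-- [folklore] **A TABLE DIVERGENCE-FREE IN ITS SECOND SOURCE SLOT IS `P₂`-FIXED** (leaf-02's `coProjBmAtK_eq_self_of_divFree`, slot by slot). -/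
theorem coProj_snd_eq_self_of_divFree (hN : 1 ≤ N) (hr : r ∈ box (d + 1) N) {X : Tab d}
    (hdiv : ∀ (κ : Fin (d + 1)) (u p x z : Fin (d + 1) → ℤ) (a b : Fib d),
      ∑ β : Fin (d + 1), (X κ u β p x z a b - X κ u β (p - unitVec β) x z a b) = 0) :
    (fun κ u => coProjBmAtK (toSite r) N (X κ u)) = X := by
  funext κ u
  exact coProjBmAtK_eq_self_of_divFree hN hr (fun p x z a b => hdiv κ u p x z a b)

/-- [folklore] **A TABLE DIVERGENCE-FREE IN ITS FIRST SOURCE SLOT IS `P₁`-FIXED**. -/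
theorem coProj_fst_eq_self_of_divFree (hN : 1 ≤ N) (hr : r ∈ box (d + 1) N) {Y : Tab d}
    (hdiv : ∀ (p : Fin (d + 1) → ℤ) (κ' : Fin (d + 1)) (u' x z : Fin (d + 1) → ℤ) (a b : Fib d),
      ∑ β : Fin (d + 1), (Y β p κ' u' x z a b - Y β (p - unitVec β) κ' u' x z a b) = 0) :
    (fun κ u κ' u' => coProjBmAtK (toSite r) N (fun κ₁ u₁ => Y κ₁ u₁ κ' u') κ u) = Y := by
  funext κ u κ' u'
  have h := coProjBmAtK_eq_self_of_divFree hN hr (S := fun κ₁ u₁ => Y κ₁ u₁ κ' u') (fun p x z a b => hdiv p κ' u' x z a b)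
  exact congrFun (congrFun h κ) u

/-- [folklore] **A KERNEL DIVERGENCE-FREE IN ITS FIRST FIELD LEG IS `legCo₁BmAt`-FIXED** (leaf-02's `coProjBmAt_eq_self_of_divFree` on the `inl` components;
the `inr` components are untouched by definition). -/
theorem legCo₁_eq_self_of_divFree (hN : 1 ≤ N) (hr : r ∈ box (d + 1) N) {V : MKer (d + 1) (Fib d)}
    (hdiv : ∀ (p z : Fin (d + 1) → ℤ) (b : Fib d), ∑ β : Fin (d + 1), (V p z (Sum.inl β) b - V (p - unitVec β) z (Sum.inl β) b) = 0) :
    legCo₁BmAt (toSite r) N V = V := by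
  funext x z a b
  rcases a with α | m
  · rw [legCo₁BmAt_inl, coProjBmAt_eq_self_of_divFree hN hr (g := fun α' x' => V x' z (Sum.inl α') b) (fun p => hdiv p z b)]
  · rw [legCo₁BmAt_inr]

/-- [folklore] **A KERNEL DIVERGENCE-FREE IN ITS SECOND FIELD LEG IS `legCo₂BmAt`-FIXED**. -/
theorem legCo₂_eq_self_of_divFree (hN : 1 ≤ N) (hr : r ∈ box (d + 1) N) {V : MKer (d + 1) (Fib d)}
    (hdiv : ∀ (x p : Fin (d + 1) → ℤ) (a : Fib d), ∑ β : Fin (d + 1), (V x p a (Sum.inl β) - V x (p - unitVec β) a (Sum.inl β)) = 0) :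
    legCo₂BmAt (toSite r) N V = V := by
  funext x z a b
  rcases b with β₀ | m
  · rw [legCo₂BmAt_inl, coProjBmAt_eq_self_of_divFree hN hr (g := fun β' y' => V x y' a (Sum.inl β')) (fun p => hdiv x p a)]
  · rw [legCo₂BmAt_inr]

/-- NOT IN PRINT; OUR BOOKKEEPING.  **A TABLE TRANSVERSAL IN ALL FOUR VARIABLES IS `𝔇`-FIXED** (in-block root, `1 ≤ N`; no decay hypothesis): if the two source
slots and the two field legs of `X` are divergence-free, then `𝔇 X = X` — on such a table the dressed and undressed linear steps coincide (`lin4_coDressKBmAt`). -/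
theorem tableDress_eq_self_of_transversal (hN : 1 ≤ N) (hr : r ∈ box (d + 1) N) {X : Tab d}
    (h₂ : ∀ (κ : Fin (d + 1)) (u p x z : Fin (d + 1) → ℤ) (a b : Fib d),
      ∑ β : Fin (d + 1), (X κ u β p x z a b - X κ u β (p - unitVec β) x z a b) = 0)
    (h₁ : ∀ (p : Fin (d + 1) → ℤ) (κ' : Fin (d + 1)) (u' x z : Fin (d + 1) → ℤ) (a b : Fib d),
      ∑ β : Fin (d + 1), (X β p κ' u' x z a b - X β (p - unitVec β) κ' u' x z a b) = 0)
    (hL₁ : ∀ (κ : Fin (d + 1)) (u : Fin (d + 1) → ℤ) (κ' : Fin (d + 1)) (u' p z : Fin (d + 1) → ℤ) (b : Fib d),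
      ∑ β : Fin (d + 1), (X κ u κ' u' p z (Sum.inl β) b - X κ u κ' u' (p - unitVec β) z (Sum.inl β) b) = 0)
    (hL₂ : ∀ (κ : Fin (d + 1)) (u : Fin (d + 1) → ℤ) (κ' : Fin (d + 1)) (u' x p : Fin (d + 1) → ℤ) (a : Fib d),
      ∑ β : Fin (d + 1), (X κ u κ' u' x p a (Sum.inl β) - X κ u κ' u' x (p - unitVec β) a (Sum.inl β)) = 0) :
    (fun κ u κ' u' => dressKBmAt (toSite r) N (coProjBmAtK (toSite r) N (fun κ₁ u₁ => coProjBmAtK (toSite r) N (X κ₁ u₁) κ' u') κ u)) = X := by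
  have e₂ : (fun κ u => coProjBmAtK (toSite r) N (X κ u)) = X := coProj_snd_eq_self_of_divFree hN hr h₂
  have e₂' : ∀ κ₁ u₁, coProjBmAtK (toSite r) N (X κ₁ u₁) = X κ₁ u₁ := fun κ₁ u₁ => congrFun (congrFun e₂ κ₁) u₁
  have e₁ : (fun κ u κ' u' => coProjBmAtK (toSite r) N (fun κ₁ u₁ => X κ₁ u₁ κ' u') κ u) = X := coProj_fst_eq_self_of_divFree hN hr h₁
  rw [tableDress_eq_legs]
  funext κ u κ' u'
  simp only [e₂']
  have e₁' : coProjBmAtK (toSite r) N (fun κ₁ u₁ => X κ₁ u₁ κ' u') κ u = X κ u κ' u' :=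
    congrFun (congrFun (congrFun (congrFun e₁ κ) u) κ') u'
  rw [e₁', legCo₁_eq_self_of_divFree hN hr (hL₁ κ u κ' u'), legCo₂_eq_self_of_divFree hN hr (hL₂ κ u κ' u')]

end Transversal

/-! ## §5 Shapes: `𝔇 X` and `𝔇 X − X` are `LocStencil₂` at the same rate -/

section Shapes

variable {N : ℕ} {r : Fin (d + 1) → ℕ}

/-- [folklore] **`𝔇` PRESERVES `LocStencil₂`** (PART 1 §2 chained: second slot `cKb`, first slot `cWb·e^{3δ(d+1)N}`, legs `cKb²`; same rate):
`LocStencil₂ X C δ → LocStencil₂ (𝔇 X) (κ_𝔇·C) δ`, `κ_𝔇 = cKb d N δ · cKb d N δ · (cWb d N · e^{3δ(d+1)N} · cKb d N δ)`. -/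
theorem locStencil₂_tableDress (hN : 1 ≤ N) (hr : r ∈ box (d + 1) N) {X : Tab d} {C δ : ℝ} (hX : LocStencil₂ X C δ) (hδ : 0 ≤ δ) :
    LocStencil₂ (fun κ u κ' u' => dressKBmAt (toSite r) N (coProjBmAtK (toSite r) N (fun κ₁ u₁ => coProjBmAtK (toSite r) N (X κ₁ u₁) κ' u') κ u))
      (cKb d N δ * cKb d N δ * (cWb d N * Real.exp (3 * δ * (((d : ℝ) + 1) * N)) * (cKb d N δ * C))) δ :=
  locStencil₂_dress hN hr (locStencil₂_coProj_fst hN hr (locStencil₂_coProj_snd hN hr hX hδ) hδ) hδ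

/-- [folklore] Difference of two `LocStencil₂` tables at one rate (constants add). -/
theorem locStencil₂_diff {A B : Tab d} {CA CB δ : ℝ} (hA : LocStencil₂ A CA δ) (hB : LocStencil₂ B CB δ) :
    LocStencil₂ (A - B) (CA + CB) δ := by
  intro κ u κ' u' x z a b
  have h1 := hA κ u κ' u' x z a b
  have h2 := hB κ u κ' u' x z a b
  show |A κ u κ' u' x z a b - B κ u κ' u' x z a b| ≤ _
  calc |A κ u κ' u' x z a b - B κ u κ' u' x z a b| ≤ |A κ u κ' u' x z a b| + |B κ u κ' u' x z a b| := abs_sub _ _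
    _ ≤ _ := by rw [add_mul, add_mul]; exact add_le_add h1 h2

/-- NOT IN PRINT; OUR BOOKKEEPING.  **THE DEFECT `𝔇 X − X` IS `LocStencil₂` AT THE SAME RATE**, constant `(κ_𝔇 + 1)·C` — the (G′)-row supplier for the first summand
`𝒜^B_j ((𝔇 − 1) T_j)` of the (R-DEV) forcing (through road W3's marginal row `hTmarg` on `𝒜^B_j`). -/
theorem locStencil₂_tableDress_sub_self (hN : 1 ≤ N) (hr : r ∈ box (d + 1) N) {X : Tab d} {C δ : ℝ} (hX : LocStencil₂ X C δ) (hδ : 0 ≤ δ) :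
    LocStencil₂ ((fun κ u κ' u' => dressKBmAt (toSite r) N (coProjBmAtK (toSite r) N (fun κ₁ u₁ => coProjBmAtK (toSite r) N (X κ₁ u₁) κ' u') κ u)) - X)
      ((cKb d N δ * cKb d N δ * (cWb d N * Real.exp (3 * δ * (((d : ℝ) + 1) * N)) * cKb d N δ) + 1) * C) δ := by
  have h := locStencil₂_diff (locStencil₂_tableDress hN hr hX hδ) hX
  have e : cKb d N δ * cKb d N δ * (cWb d N * Real.exp (3 * δ * (((d : ℝ) + 1) * N)) * (cKb d N δ * C)) + C
      = (cKb d N δ * cKb d N δ * (cWb d N * Real.exp (3 * δ * (((d : ℝ) + 1) * N)) * cKb d N δ) + 1) * C := by ring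
  rw [e] at h
  exact h

/-- [folklore] A `LocStencil₂` table (rate `δ ≥ 0`) has uniformly bounded entries (bound = its constant). -/
theorem bdd_of_locStencil₂ {X : Tab d} {C δ : ℝ} (hX : LocStencil₂ X C δ) (hδ : 0 ≤ δ) :
    ∀ κ u κ' u' x z a b, |X κ u κ' u' x z a b| ≤ C := by
  intro κ u κ' u' x z a b
  have hC : 0 ≤ C := hX.nonneg
  have h := hX κ u κ' u' x z a b
  have e1 : Real.exp (-δ * l1 (u' - u)) ≤ 1 := Real.exp_le_one_iff.2 (by nlinarith [l1_nonneg (u' - u)])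
  have e2 : Real.exp (-δ * (l1 (x - u) + l1 (z - u))) ≤ 1 :=
    Real.exp_le_one_iff.2 (by nlinarith [l1_nonneg (x - u), l1_nonneg (z - u)])
  calc |X κ u κ' u' x z a b| ≤ C * Real.exp (-δ * l1 (u' - u)) * Real.exp (-δ * (l1 (x - u) + l1 (z - u))) := h
    _ ≤ C * 1 * 1 := by
        refine mul_le_mul (mul_le_mul_of_nonneg_left e1 hC) e2 (Real.exp_pos _).le ?_
        exact mul_nonneg hC zero_le_one
    _ = C := by ring

end Shapes

/-! ## §6 The one-level difference `𝒜^E X − 𝒜^B X = 𝒜^B (𝔇 X − X)` -/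

section OneLevel

variable {N : ℕ} {r : Fin (d + 1) → ℕ}

/-- NOT IN PRINT; OUR BOOKKEEPING.  **THE ONE-LEVEL DIFFERENCE** (the row owner's (R-CT) re-cut of `lin4_coDressKBmAt`; decaying `K` at rate `m > 0`, `LocStencil₂` table
at the same rate, in-block root, `1 ≤ N`, any `c`): `lin4 c (coDressKBmAt ρ N K) N X − lin4 c K N X = lin4 c K N (𝔇 X − X)` — the dressed minus the undressed
linear step is ONE undressed step applied to the four contact cells of §2–§3 (PART 1 `lin4_coDressKBmAt` + leaf-01's `lin4_sub` on the bounded class). -/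
theorem lin4_coDressKBmAt_sub (hN : 1 ≤ N) (hr : r ∈ box (d + 1) N) {K : MKer (d + 1) (Fib d)} {C m : ℝ} (hK : Decays K C m) (hm : 0 < m)
    {X : Tab d} {CX : ℝ} (hX : LocStencil₂ X CX m) (c : ℝ) :
    lin4 c (coDressKBmAt (toSite r) N K) N X - lin4 c K N X
      = lin4 c K N ((fun κ u κ' u' => dressKBmAt (toSite r) N
          (coProjBmAtK (toSite r) N (fun κ₁ u₁ => coProjBmAtK (toSite r) N (X κ₁ u₁) κ' u') κ u)) - X) := by
  have hCX : 0 ≤ CX := hX.nonneg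
  set κD : ℝ := cKb d N m * cKb d N m * (cWb d N * Real.exp (3 * m * (((d : ℝ) + 1) * N)) * cKb d N m) with hκD
  have hκD0 : 0 ≤ κD := by
    rw [hκD]
    exact mul_nonneg (mul_nonneg (cKb_nonneg _ _ _) (cKb_nonneg _ _ _))
      (mul_nonneg (mul_nonneg (cWb_nonneg _ _) (Real.exp_pos _).le) (cKb_nonneg _ _ _))
  -- both tables lie in the bounded class with the common bound `(κ_𝔇 + 1)·CX`
  have hD : LocStencil₂ (fun κ u κ' u' => dressKBmAt (toSite r) N
      (coProjBmAtK (toSite r) N (fun κ₁ u₁ => coProjBmAtK (toSite r) N (X κ₁ u₁) κ' u') κ u)) (κD * CX) m := by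
    have h := locStencil₂_tableDress hN hr hX hm.le
    have e : cKb d N m * cKb d N m * (cWb d N * Real.exp (3 * m * (((d : ℝ) + 1) * N)) * (cKb d N m * CX)) = κD * CX := by
      rw [hκD]; ring
    rw [e] at h
    exact h
  have b1 : ∀ κ u κ' u' x z a b, |(fun κ u κ' u' => dressKBmAt (toSite r) N
      (coProjBmAtK (toSite r) N (fun κ₁ u₁ => coProjBmAtK (toSite r) N (X κ₁ u₁) κ' u') κ u)) κ u κ' u' x z a b| ≤ (κD + 1) * CX :=
    fun κ u κ' u' x z a b => (bdd_of_locStencil₂ hD hm.le κ u κ' u' x z a b).trans (by nlinarith)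
  have b2 : ∀ κ u κ' u' x z a b, |X κ u κ' u' x z a b| ≤ (κD + 1) * CX :=
    fun κ u κ' u' x z a b => (bdd_of_locStencil₂ hX hm.le κ u κ' u' x z a b).trans (by nlinarith)
  rw [lin4_coDressKBmAt hN hr hK hm hX c, ← lin4_sub hK hm c N b1 b2]

/-- NOT IN PRINT; OUR BOOKKEEPING.  **THE ONE-LEVEL DIFFERENCE AT THE COMB SLOT, ADOPTED UNITS** (PART 2 `lin4_comb_coDressKBmAt`; every `j`, every in-block root, every
`LocStencil₂` table of positive rate, any `c`): with `𝒜^B_j := lin4 c (unitK (sfStep Lc j) (smStep d Lc j) (KInvStep Lc j)) Lc` (road W3's map) and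
`𝒜^E_j := lin4 c (unitK (sfStep Lc j) (smStep d Lc j) (coDressKBmAt ρ Lc (KInvStep Lc j))) Lc` (the dressed tower's map, p2's (F1)),
`𝒜^E_j X − 𝒜^B_j X = 𝒜^B_j (𝔇 X − X)` — the first summand of the (R-DEV) forcing `g′_j` as ONE undressed step of the four contact cells. -/
theorem lin4_comb_coDressKBmAt_sub {Lc : ℕ} [NeZero Lc] (hr : r ∈ box (d + 1) Lc) (j : ℕ) {X : Tab d} {CX δX : ℝ} (hX : LocStencil₂ X CX δX)
    (hδX : 0 < δX) (c : ℝ) :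
    lin4 c (unitK (sfStep Lc j) (smStep d Lc j) (coDressKBmAt (toSite r) Lc (KInvStep (d := d) Lc j))) Lc X
        - lin4 c (unitK (sfStep Lc j) (smStep d Lc j) (KInvStep (d := d) Lc j)) Lc X
      = lin4 c (unitK (sfStep Lc j) (smStep d Lc j) (KInvStep (d := d) Lc j)) Lc
          ((fun κ u κ' u' => dressKBmAt (toSite r) Lc
            (coProjBmAtK (toSite r) Lc (fun κ₁ u₁ => coProjBmAtK (toSite r) Lc (X κ₁ u₁) κ' u') κ u)) - X) := by
  have hLc : 1 ≤ Lc := one_le_of_neZero Lc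
  obtain ⟨δK, CK, hδK, hCK, hK⟩ := decays_KInvStep (d := d) (Lc := Lc) j
  have hm : 0 < min δK δX := lt_min hδK hδX
  have hK' : Decays (KInvStep (d := d) Lc j) CK (min δK δX) := decays_mono hK hCK le_rfl (min_le_left _ _)
  have hX' : LocStencil₂ X CX (min δK δX) := hX.mono (min_le_right _ _)
  rw [HessKerCoDressedBmWall.unitK_coDressKBmAt (toSite r) Lc (sfStep_ne_zero j) (smStep_ne_zero j)]
  exact lin4_coDressKBmAt_sub hLc hr (decays_unitK hK') hm hX' c

end OneLevel

end Summit.QuantumFields.BalabanUV.Beta.GAN24.TableDressingDefect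

end
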